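import Summits.QuantumFields.BalabanUV.Beta.CapRowsTail
import Summits.QuantumFields.BalabanUV.Beta.GAN24.CombesThomas

/-!
# Beta / GAN24 / Monotone — the MONOTONICITY ∕ CONTRACTION-in-`k` route to the tail of `β⁰_{k+1}` (gan24-p4)
# BINDER-OWNERS row G-an2-4 ∕ (CONV-C), ALTERNATIVE DISCHARGE «rate OR monotonicity»; NOT IN PRINT — our proof attempt

HONEST FRAMING (page 1 of everything the β sub-cell writes): discharging `BetaPertH` makes Bałaban's UV stability UNCONDITIONAL — a
real constructive-QFT result; it is NOT the continuum limit and NOT the Clay problem.  HONEST DEPENDENCY (cell reorg 2026-08-19, verbatim):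
«continuum YM on T⁴ ⇐ BetaPertH ∧ nine spine estimates (0/9 proved); BetaPertH ⇐ (D1) ∧ (D4) ∧ CAP+tail; G-an2-4 gates asym, D1 and NE2/3/4.»
HONEST LABEL of this file: «not in print; our proof attempt; alternative discharge of the G-an2-4 row (rate OR monotonicity)».  G-an2-4 =
the non-abelian one-step η-RATE comparison of the constituent kernels `(G_k, H_k, C^{(k)})` at `U = 1` that [Balaban1987RG1] p. 264 defers to
«a separate paper»; it gates asym1's `LimitForm.conv`, the wall binder (D1) and the T⁴ spine nodes NE2∕NE3∕NE4.  THIS FILE REPLACES THE RATE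
BY MONOTONICITY where the consumer only needs the TAIL of `β⁰`: the (R15) certified road of row CAP-k (`CapRows.Rows`, beta-an5) asks for a
FLOOR `f ≤ β⁰_{k+1}` for all `k`, not for summable increments.

ABSOLUTE RULE (cell charter, verbatim): "No internally-minted statement may enter as a cited fact. Every hypothesis is either
kernel-proved in this package or a verbatim quotation of a PUBLISHED theorem with page reference. The manuscript(s) under audit are
NOT citable for their own disputed steps — they are the thing under adjudication; programme-internal (2001/route/tribunal) claims
are never citable."  Nothing below is cited; every hypothesis is an explicit binder SHAPE with parameters; 0 binders are instantiated for
Bałaban's families.  [folklore] throughout = elementary real analysis ∕ bookkeeping on the tree's own kernel calculus.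

## THE STATEMENT (Lean statement first).  Sequence: `b = S.β0` (`S : B12Beta.OneLoopSplit β`, `S.β0 k = β⁰_{k+1}` of (2.12)–(2.14)),
read through the wall's dictionary `S.β0 j = secondMoment (hessKer (A j) (V j) (W j)) μ ν` (asym1 ∕ an2: `OneStepKernelFamily.TbalOf`,
`HessKerDressedUnitsWall`; the binder `hβ` below).  Direction ∕ limit ∕ factor: the route does NOT assert that `β⁰_{k+1}` itself is
monotone (OBSTRUCTION O-gan24p4-1, `HOME/b2b-balaban-gan24-p4/MONOTONE.md` §3: the (1.22) functional `A ↦ secondMoment (hessKer A V W)` is a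
tadpole MINUS a bubble — not order-preserving in the propagator, so the Loewner monotonicity of the constituents, which IS structural
(asym1 `Beta.MonotoneScales`: `φ^{(RN)} ≤ φ^{(N)}`, `D^{(N)} ≤ D^{(RN)}`, `QGQ*^{(RN)} ≤ QGQ*^{(N)}`), does not transfer to `β⁰`).  What it
asserts instead is the shape the consumer actually needs, an EVENTUAL BAND

  `EventualBand b binf E k₀ : ∀ k ≥ k₀, |b k − binf| ≤ E`                                       (§1; `binf` = the second moment of the limit kernels,
                                                                                                  = `stepBal N Lc` under row D1's identification),
obtained WITHOUT ANY RATE from (§3–§5):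
  (MONO-K)  `SupDev A A∞ η ∧ MonotoneTailDown η k₀` — the sup-norm deviations of the resolvent slot from its limit are DOMINATED by a
            majorant `η` that is NON-INCREASING from `k₀` on (an5's socket `MonotoneTailDown`, applied to the majorant, not to `β⁰`); for
            Loewner-ordered real-zone fibre matrices `P∞ ≤ P_{k+1} ≤ P_k` this is automatic with `η k = sup‖P_k − P∞‖` (the structural
            input; for Bałaban's `U = 1` primitives it is asym1's `MonotoneScales`, for the packed KKT resolvent `KInvStep` it is OPEN —
            stub S-gan24p4-K of the report);
  (I3)      `j`-uniform exponential decay of the constituents (the SAME open input as roads P1∕P2∕P3; binder);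
  (DEV-SW)  eventual deviations of the explicit averaging jets `V j → V∞`, `W j → W∞` in the vertex classes (binder; elementary for the
            composite averaging stencils, not typed here);
  ONE DATUM `η k₀` (certifiable at a small `k₀`; qualitatively free by monotone convergence).
Mechanism: p1's interpolation step `decays_half_of_decays_supBound` (King (4.38), `min ≤ geometric mean`) turns (I3) + the eventual sup
bound `η k₀` into eventual WEIGHTED deviations `√(η k₀·2C)` at half the rate; asym1's Lipschitz estimate `HessKerRate.decay510_hessKer_sub`
(used through `geomRate_secondMoment_hessKer` AT RATIO `θ = 1` on the shifted family) turns those into the band constant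
`bandConst = betaPrime510 D (lipConst … √(η k₀·2C) εV εW) (δ/8)`; an5's rows `CapRows.Rows S.β0` serve `k ≤ k₀`; the floor
`min m₀ (binf − bandConst)` feeds `RemainderConstCertified.betaLowerH_of_floor_const` + `AveragedAFCarrier.betaAvgAFH_of_betaLowerH`.

## THE MEETING THEOREMS (coordinator 2026-08-19T22:17Z «certified rows and p4's statement meet in ONE Lean theorem»; names per
`HOME/BETA/GAN24-NAMES.md` § beta-an5 B, confirmed in § gan24-p4): `betaAvgAFH_of_rows_eventualBand` (rows × band, §2) and the end-to-end
`betaAvgAFH_of_rows_monotoneMajorant` (§5) whose CAP hypothesis is LITERALLY `c : CapRows.Rows S.β0` (beta-an5, p197171) and whose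
monotonicity hypothesis is LITERALLY `CapRowsTail.MonotoneTailDown η k₀` (beta-an5, p197922).  §1 also records how an5's three sockets and the
asymptotic lane's `GeomRate` each GIVE a band (`eventualBand_of_contractingTail ∕ _of_monotoneTailDown ∕ _of_geomRate`), so every producer
currency lands in the same END.  NOT `BetaPertH`, NOT continuum, NOT Clay; 0 binders instantiated.
-/

namespace Summit.QuantumFields.BalabanUV.Beta.GAN24.Monotone

open Filter Topology
open Literature.MathematicalPhysics.QuantumFieldTheory.Balaban1983to89
open Literature.MathematicalPhysics.QuantumFieldTheory.Balaban1983to89.Beta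
open FlowStep
open B12Sec2to5 (betaPrime510)
open B12Beta (secondMoment)
open ExpKernelCalculus (Site MKer Decays VertexFamily VertexFamily₂ hessKer)
open HessKerRate (lipConst decays_sub geomRate_secondMoment_hessKer)
open Beta.RemainderChain (RemainderConst)
open Beta.RateCertificate (GeomRate)
open Beta.AveragedAFCarrier (BetaAvgAFH betaAvgAFH_of_betaLowerH)
open Beta.RemainderConstCertified (betaLowerH_of_floor_const)
open Summit.QuantumFields.BalabanUV.Beta.CapRows
open Summit.QuantumFields.BalabanUV.Beta.CapRowsTail
open Summit.QuantumFields.BalabanUV.Beta.GAN24.CombesThomas (SupBound decays_half_of_decays_supBound decays_of_le_rate)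

/-! ## §1 The band shape and how every producer currency gives it -/

section Shapes

variable {b : ℕ → ℝ}

/-- SOCKET (B): an EVENTUAL BAND of half-width `E` around `binf` from `k₀` on — `∀ k ≥ k₀, |b k − binf| ≤ E`.  The shape the certified
road's floor needs from the tail; weaker than every rate and than every monotonicity-with-limit. A binder shape; nothing asserted. [folklore] -/
def EventualBand (b : ℕ → ℝ) (binf E : ℝ) (k₀ : ℕ) : Prop := ∀ k, k₀ ≤ k → |b k - binf| ≤ E

/-- A band may be widened and started later. [folklore] -/
theorem EventualBand.mono {binf E E' : ℝ} {k₀ k₁ : ℕ} (h : EventualBand b binf E k₀) (hE : E ≤ E') (hk : k₀ ≤ k₁) :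
    EventualBand b binf E' k₁ := fun k hk' => (h k (hk.trans hk')).trans hE

/-- The half-width of an inhabited band is nonnegative. [folklore] -/
theorem EventualBand.nonneg {binf E : ℝ} {k₀ : ℕ} (h : EventualBand b binf E k₀) : 0 ≤ E :=
  (abs_nonneg _).trans (h k₀ le_rfl)

/-- (M↓) propagates downward: `b k ≤ b k₀` for `k ≥ k₀`. [folklore] -/
theorem le_of_monotoneTailDown {k₀ : ℕ} (h : MonotoneTailDown b k₀) : ∀ k, k₀ ≤ k → b k ≤ b k₀ := by
  intro k hk
  induction k, hk using Nat.le_induction with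
  | base => exact le_rfl
  | succ n hn ih => exact (h n hn).trans ih

/-- **(C) ⟹ (B)**: contraction at ratio `θ ∈ [0,1]` towards `binf` from `k₀` and ONE datum `|b k₀ − binf| ≤ D` give the band of
half-width `D` — NO SHARP RATE (even `θ = 1`). [folklore] -/
theorem eventualBand_of_contractingTail {binf θ D : ℝ} {k₀ : ℕ} (h : ContractingTail b binf θ k₀) (hθ0 : 0 ≤ θ) (hθ1 : θ ≤ 1)
    (hD : |b k₀ - binf| ≤ D) : EventualBand b binf D k₀ := by
  intro k hk
  calc |b k - binf| ≤ θ ^ (k - k₀) * |b k₀ - binf| := abs_sub_le_of_contractingTail h hθ0 k hk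
    _ ≤ 1 * D := mul_le_mul (pow_le_one₀ hθ0 hθ1) hD (abs_nonneg _) zero_le_one
    _ = D := one_mul D

/-- **(M↓ + limit) ⟹ (B)**: a non-increasing tail with limit `binf` and ONE upper datum `b k₀ ≤ binf + D` give the (one-sided, hence
two-sided) band of half-width `D`. [folklore] -/
theorem eventualBand_of_monotoneTailDown {binf D : ℝ} {k₀ : ℕ} (h : MonotoneTailDown b k₀) (hlim : Tendsto b atTop (𝓝 binf))
    (hup : b k₀ ≤ binf + D) : EventualBand b binf D k₀ := by
  intro k hk
  have hlo := limit_le_of_monotoneTailDown h hlim k hk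
  have hhi := le_of_monotoneTailDown h k hk
  rw [abs_le]
  constructor <;> linarith

/-- **(M↑ + limit) ⟹ (B)**: symmetrically, a non-decreasing tail with limit `binf` and ONE lower datum `binf − D ≤ b k₀`. [folklore] -/
theorem eventualBand_of_monotoneTailUp {binf D : ℝ} {k₀ : ℕ} (h : MonotoneTailUp b k₀) (hlim : Tendsto b atTop (𝓝 binf))
    (hlo : binf - D ≤ b k₀) : EventualBand b binf D k₀ := by
  intro k hk
  have h1 := le_of_monotoneTailUp h k hk
  -- a non-decreasing tail stays below its limit
  have hmono : Monotone fun j : ℕ => b (k + j) := by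
    refine monotone_nat_of_le_succ fun j => ?_
    show b (k + j) ≤ b (k + (j + 1))
    rw [← Nat.add_assoc]
    exact h (k + j) (by omega)
  have hlim' : Tendsto (fun j : ℕ => b (k + j)) atTop (𝓝 binf) :=
    hlim.comp (tendsto_atTop_atTop.mpr fun n => ⟨n, fun j hj => by omega⟩)
  have h2 : b k ≤ binf := by simpa using hmono.ge_of_tendsto hlim' 0
  rw [abs_le]
  constructor <;> linarith

/-- **RATE ⟹ (B)**: the asymptotic lane's `GeomRate b binf c₀ θ` (`0 ≤ θ ≤ 1`) gives the band of half-width `c₀θ^{k₀}` from every `k₀`. [folklore] -/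
theorem eventualBand_of_geomRate {binf c₀ θ : ℝ} (h : GeomRate b binf c₀ θ) (hθ0 : 0 ≤ θ) (hθ1 : θ ≤ 1) (k₀ : ℕ) :
    EventualBand b binf (c₀ * θ ^ k₀) k₀ := fun k hk =>
  (h k).trans (mul_le_mul_of_nonneg_left (pow_le_pow_of_le_one hθ0 hθ1 hk) (Beta.RateCertificate.GeomRate.const_nonneg h))

end Shapes

/-! ## §2 ROWS × BAND: the floor and the (R15) carrier — meeting theorem no. 1 -/

section RowsBand

variable {b : ℕ → ℝ}

/-- **ROWS × (B)**: certified rows up to `k₀` (`CapRows.Rows`, beta-an5) and a band from some `kb ≤ k₀ + 1` ⟹ the floor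
`min m₀ (binf − E) ≤ b k` for EVERY `k`. [folklore] -/
theorem floor_of_rows_eventualBand (c : Rows b) {binf E : ℝ} {kb : ℕ} (h : EventualBand b binf E kb) (hkb : kb ≤ c.k₀ + 1) :
    ∀ k, min ((c.m₀ : ℚ) : ℝ) (binf - E) ≤ b k := by
  intro k
  rcases lt_or_ge k (c.k₀ + 1) with hk | hk
  · exact (min_le_left _ _).trans (c.hsmall k hk)
  · have := (abs_le.mp (h k (hkb.trans hk))).1
    exact (min_le_right _ _).trans (by linarith)

variable {β : HBeta}

/-- **END (B) — MEETING THEOREM no. 1**: `OneLoopSplit S`, certified rows `c : CapRows.Rows S.β0` (LITERALLY beta-an5's carrier), a band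
`EventualBand S.β0 binf E kb` with `kb ≤ k₀ + 1`, and the constant remainder `RemainderConst S γ₀ r` ⟹ `BetaAvgAFH (min m₀ (binf − E) − r) 0 γ₀ β`
(= `RemainderConstCertified.betaLowerH_of_floor_const` + `AveragedAFCarrier.betaAvgAFH_of_betaLowerH`, as in an5's three ENDs).  Useful iff
`min m₀ (binf − E) > r` downstream. [folklore] -/
theorem betaAvgAFH_of_rows_eventualBand (S : B12Beta.OneLoopSplit β) (c : Rows S.β0) {binf E : ℝ} {kb : ℕ}
    (h : EventualBand S.β0 binf E kb) (hkb : kb ≤ c.k₀ + 1) {γ₀ r : ℝ} (hrem : RemainderConst S γ₀ r) :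
    BetaAvgAFH (min ((c.m₀ : ℚ) : ℝ) (binf - E) - r) 0 γ₀ β :=
  betaAvgAFH_of_betaLowerH (betaLowerH_of_floor_const S (floor_of_rows_eventualBand c h hkb) hrem)

/-- The (C)-currency END of an5 re-derived through the band (same floor `min m₀ (binf − θD)` when the datum is taken at ratio `θ`:
here the cruder `min m₀ (binf − D)`, valid for every `θ ≤ 1`). [folklore] -/
theorem betaAvgAFH_of_rows_contracting_band (S : B12Beta.OneLoopSplit β) (c : Rows S.β0) {binf θ D : ℝ}
    (h : ContractingTail S.β0 binf θ c.k₀) (hθ0 : 0 ≤ θ) (hθ1 : θ ≤ 1) (hD : |S.β0 c.k₀ - binf| ≤ D) {γ₀ r : ℝ}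
    (hrem : RemainderConst S γ₀ r) : BetaAvgAFH (min ((c.m₀ : ℚ) : ℝ) (binf - D) - r) 0 γ₀ β :=
  betaAvgAFH_of_rows_eventualBand S c (eventualBand_of_contractingTail h hθ0 hθ1 hD) (Nat.le_succ _) hrem

end RowsBand

/-! ## §3 THE BAND FROM THE KERNEL CALCULUS: eventual (non-geometric) deviations of the ingredients ⟹ band of the (1.22)-moments
(asym1's Lipschitz estimate `HessKerRate.decay510_hessKer_sub`, consumed through `geomRate_secondMoment_hessKer` at ratio `θ = 1`) -/

section KernelBand

variable {D : ℕ} {F : Type*} [Fintype F]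
  {A : ℕ → MKer D F} {Ainf : MKer D F} {V : ℕ → Fin D → Site D → MKer D F} {Vinf : Fin D → Site D → MKer D F}
  {W : ℕ → Fin D → Site D → Fin D → Site D → MKer D F} {Winf : Fin D → Site D → Fin D → Site D → MKer D F}
  {C Cv Cw εA εV εW δ : ℝ} {N k₀ : ℕ}

/-- **EVENTUAL DEVIATIONS ⟹ BAND OF THE MOMENTS.**  `j`-uniform decay data for `(A j, V j, W j)` and the limits `(A∞, V∞, W∞)`, and from
`k₀` on the deviations `Decays (A j − A∞) εA δ`, `VertexFamily (V j − V∞) N εV δ`, `VertexFamily₂ (W j − W∞) N εW δ` — constants NOT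
depending on `j`, NO rate — give `|secondMoment (hessKer (A j) (V j) (W j)) μ ν − secondMoment (hessKer A∞ V∞ W∞) μ ν| ≤
betaPrime510 D (lipConst D |F| δ C C Cv Cv Cw εA εV εW) (δ/4)` for all `j ≥ k₀`.  Proof: asym1's `geomRate_secondMoment_hessKer` on the
shifted family `j ↦ (A (k₀+j), V (k₀+j), W (k₀+j))` with `θ = 1`. [folklore] -/
theorem eventualBand_secondMoment_hessKer (hA : ∀ j, Decays (A j) C δ) (hAinf : Decays Ainf C δ)
    (hV : ∀ j, VertexFamily (V j) N Cv δ) (hVinf : VertexFamily Vinf N Cv δ)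
    (hW : ∀ j, VertexFamily₂ (W j) N Cw δ) (hWinf : VertexFamily₂ Winf N Cw δ)
    (hAdev : ∀ j, k₀ ≤ j → Decays (A j - Ainf) εA δ) (hVdev : ∀ j, k₀ ≤ j → VertexFamily (V j - Vinf) N εV δ)
    (hWdev : ∀ j, k₀ ≤ j → VertexFamily₂ (W j - Winf) N εW δ) (hδ : 0 < δ) (hN : 1 ≤ N) (μ ν : Fin D) :
    EventualBand (fun j => secondMoment (hessKer (A j) (V j) (W j)) μ ν) (secondMoment (hessKer Ainf Vinf Winf) μ ν)
      (betaPrime510 D (lipConst D (Fintype.card F) δ C C Cv Cv Cw εA εV εW) (δ / 4)) k₀ := by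
  intro k hk
  have h := geomRate_secondMoment_hessKer (θ := 1) (cA := εA) (cV := εV) (cW := εW)
    (A := fun j => A (k₀ + j)) (V := fun j => V (k₀ + j)) (W := fun j => W (k₀ + j))
    (fun j => hA (k₀ + j)) hAinf (fun j => by simpa using hAdev (k₀ + j) (Nat.le_add_right _ _))
    (fun j => hV (k₀ + j)) hVinf (fun j => by simpa using hVdev (k₀ + j) (Nat.le_add_right _ _))
    (fun j => hW (k₀ + j)) hWinf (fun j => by simpa using hWdev (k₀ + j) (Nat.le_add_right _ _)) hδ hN μ ν (k - k₀)
  simp only [one_pow, mul_one] at h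
  rwa [Nat.add_sub_cancel' hk] at h

end KernelBand

/-! ## §4 THE MONOTONE MAJORANT: a rate-free discharge of the eventual deviation of the resolvent slot
(an5's `MonotoneTailDown` applied to a sup-norm MAJORANT `η` of `A j − A∞`, + (I3) uniform decay, via p1's `decays_half_of_decays_supBound`) -/

section Majorant

variable {D : ℕ} {F : Type*} {A : ℕ → MKer D F} {Ainf : MKer D F} {η : ℕ → ℝ} {C δ η₀ : ℝ} {k₀ : ℕ}

/-- SOCKET (MONO-K, domination half): the sup-norm deviations of the family from its limit are DOMINATED by `η`:
`SupBound (A j − A∞) (η j)` for every `j` (p1's `SupBound`: entrywise, no decay).  A binder shape; nothing asserted. [folklore] -/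
def SupDev (A : ℕ → MKer D F) (Ainf : MKer D F) (η : ℕ → ℝ) : Prop := ∀ j, SupBound (A j - Ainf) (η j)

/-- A sup bound may be enlarged. [folklore] -/
theorem supBound_mono {X : MKer D F} {ε ε' : ℝ} (h : SupBound X ε) (hle : ε ≤ ε') : SupBound X ε' :=
  fun x y a b => (h x y a b).trans hle

/-- **(MONO-K) ⟹ EVENTUAL SUP BOUND FROM ONE DATUM**: domination by `η` + `MonotoneTailDown η k₀` (an5's socket, on the MAJORANT) ⟹
`SupBound (A j − A∞) (η k₀)` for every `j ≥ k₀`. [folklore] -/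
theorem eventualSup_of_supDev_monotone (hdev : SupDev A Ainf η) (hmono : MonotoneTailDown η k₀) :
    ∀ j, k₀ ≤ j → SupBound (A j - Ainf) (η k₀) := fun j hj =>
  supBound_mono (hdev j) (le_of_monotoneTailDown hmono j hj)

/-- **(I3) + EVENTUAL SUP BOUND ⟹ EVENTUAL WEIGHTED DEVIATION, NO RATE** (p1's interpolation step, King (4.38)): uniform decay
`Decays (A j) C δ`, `Decays A∞ C δ` and `SupBound (A j − A∞) η₀` (`η₀ ≥ 0`) for `j ≥ k₀` ⟹ `Decays (A j − A∞) √(η₀·(C + C)) (δ/2)` for `j ≥ k₀`.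
[folklore] -/
theorem eventualDecays_of_uniform_eventualSup (hA : ∀ j, Decays (A j) C δ) (hAinf : Decays Ainf C δ) (hη : 0 ≤ η₀)
    (hsup : ∀ j, k₀ ≤ j → SupBound (A j - Ainf) η₀) :
    ∀ j, k₀ ≤ j → Decays (A j - Ainf) (Real.sqrt (η₀ * (C + C))) (δ / 2) := fun j hj =>
  decays_half_of_decays_supBound (decays_sub (hA j) hAinf) hη (hsup j hj)

/-- The two steps composed: (MONO-K) + (I3) ⟹ eventual weighted deviations with constant `√(η k₀·2C)` at rate `δ/2`. [folklore] -/
theorem eventualDecays_of_supDev_monotone (hA : ∀ j, Decays (A j) C δ) (hAinf : Decays Ainf C δ) (hdev : SupDev A Ainf η)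
    (hmono : MonotoneTailDown η k₀) (hη : 0 ≤ η k₀) :
    ∀ j, k₀ ≤ j → Decays (A j - Ainf) (Real.sqrt (η k₀ * (C + C))) (δ / 2) :=
  eventualDecays_of_uniform_eventualSup hA hAinf hη (eventualSup_of_supDev_monotone hdev hmono)

/-- NON-VACUITY: a constant family is dominated by the zero majorant, which is non-increasing. [folklore] -/
theorem supDev_const (Ainf : MKer D F) : SupDev (fun _ => Ainf) Ainf (fun _ => 0) ∧ MonotoneTailDown (fun _ : ℕ => (0 : ℝ)) 0 :=
  ⟨fun j x y a b => by simp, fun _ _ => le_rfl⟩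

end Majorant

/-! ## §5 ASSEMBLY — meeting theorem no. 2: rows × (MONO-K) × (I3) × (DEV-SW) × dictionary × limit identification ⟹ the carrier -/

section Assembly

variable {D : ℕ} {F : Type*} [Fintype F]
  {A : ℕ → MKer D F} {Ainf : MKer D F} {V : ℕ → Fin D → Site D → MKer D F} {Vinf : Fin D → Site D → MKer D F}
  {W : ℕ → Fin D → Site D → Fin D → Site D → MKer D F} {Winf : Fin D → Site D → Fin D → Site D → MKer D F}
  {η : ℕ → ℝ} {C Cv Cw εV εW δ : ℝ} {N k₀ : ℕ} {μ ν : Fin D}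

/-- THE BAND CONSTANT of the route: `betaPrime510 D (lipConst D cF (δ/2) C C Cv Cv Cw √(η₀·(C + C)) εV εW) ((δ/2)/4)` — asym1's explicit
Lipschitz constant at the interpolated deviation `√(η₀·2C)` of the resolvent slot and the eventual deviations `εV, εW` of the jets, all at the
halved rate `δ/2`. [folklore] -/
noncomputable def bandConst (D : ℕ) (cF δ C Cv Cw η₀ εV εW : ℝ) : ℝ :=
  betaPrime510 D (lipConst D cF (δ / 2) C C Cv Cv Cw (Real.sqrt (η₀ * (C + C))) εV εW) (δ / 2 / 4)

/-- **THE BAND OF THE MOMENTS FROM (MONO-K) + (I3) + (DEV-SW)** — no rate anywhere: resolvent slot `A j` with `j`-uniform decay `(C, δ)` and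
limit `A∞` in the same class, sup-deviations dominated by `η` with `MonotoneTailDown η k₀`; jets `V j, W j` with uniform data at rate `δ/2` and
eventual deviations `εV, εW` from `k₀`; then the moments of `hessKer (A j) (V j) (W j)` stay within `bandConst … (η k₀) εV εW` of the moment of
the limit kernel for all `j ≥ k₀`. [folklore] -/
theorem eventualBand_secondMoment_of_monotoneMajorant (hA : ∀ j, Decays (A j) C δ) (hAinf : Decays Ainf C δ) (hC : 0 ≤ C)
    (hdev : SupDev A Ainf η) (hmono : MonotoneTailDown η k₀) (hη : 0 ≤ η k₀)
    (hV : ∀ j, VertexFamily (V j) N Cv (δ / 2)) (hVinf : VertexFamily Vinf N Cv (δ / 2))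
    (hW : ∀ j, VertexFamily₂ (W j) N Cw (δ / 2)) (hWinf : VertexFamily₂ Winf N Cw (δ / 2))
    (hVdev : ∀ j, k₀ ≤ j → VertexFamily (V j - Vinf) N εV (δ / 2)) (hWdev : ∀ j, k₀ ≤ j → VertexFamily₂ (W j - Winf) N εW (δ / 2))
    (hδ : 0 < δ) (hN : 1 ≤ N) (μ ν : Fin D) :
    EventualBand (fun j => secondMoment (hessKer (A j) (V j) (W j)) μ ν) (secondMoment (hessKer Ainf Vinf Winf) μ ν)
      (bandConst D (Fintype.card F) δ C Cv Cw (η k₀) εV εW) k₀ := by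
  have hδ2 : δ / 2 ≤ δ := by linarith
  exact eventualBand_secondMoment_hessKer (fun j => decays_of_le_rate (hA j) hC hδ2) (decays_of_le_rate hAinf hC hδ2) hV hVinf hW hWinf
    (eventualDecays_of_supDev_monotone hA hAinf hdev hmono hη) hVdev hWdev (by linarith) hN μ ν

variable {β : HBeta}

/-- **MEETING THEOREM no. 2 (end to end): ROWS × MONOTONE MAJORANT ⟹ THE (R15) CARRIER, WITHOUT THE G-an2-4 RATE.**  Hypotheses, each a named
binder of the cell (nothing instantiated): `c : CapRows.Rows S.β0` (row CAP-k, LITERALLY beta-an5's carrier); the dictionary `hβ` (row D1 ∕ the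
wall's `TbalOf` reading of `β⁰_{j+1}`); the limit identification `hlim` (row D1: `= stepBal N Lc` for Bałaban's limits); (I3) `hA, hAinf`; (MONO-K)
`hdev, hmono` with the datum `η k₀`; (DEV-SW) `hV … hWdev`; `k₀ ≤ c.k₀ + 1` (the rows reach the band); (D4)-constant remainder `hrem`.  Conclusion:
`BetaAvgAFH (min m₀ (binf − bandConst …) − r) 0 γ₀ β`. [folklore] -/
theorem betaAvgAFH_of_rows_monotoneMajorant (S : B12Beta.OneLoopSplit β) (c : Rows S.β0) {binf : ℝ}
    (hβ : ∀ j, S.β0 j = secondMoment (hessKer (A j) (V j) (W j)) μ ν) (hlim : secondMoment (hessKer Ainf Vinf Winf) μ ν = binf)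
    (hA : ∀ j, Decays (A j) C δ) (hAinf : Decays Ainf C δ) (hC : 0 ≤ C)
    (hdev : SupDev A Ainf η) (hmono : MonotoneTailDown η k₀) (hη : 0 ≤ η k₀) (hk₀ : k₀ ≤ c.k₀ + 1)
    (hV : ∀ j, VertexFamily (V j) N Cv (δ / 2)) (hVinf : VertexFamily Vinf N Cv (δ / 2))
    (hW : ∀ j, VertexFamily₂ (W j) N Cw (δ / 2)) (hWinf : VertexFamily₂ Winf N Cw (δ / 2))
    (hVdev : ∀ j, k₀ ≤ j → VertexFamily (V j - Vinf) N εV (δ / 2)) (hWdev : ∀ j, k₀ ≤ j → VertexFamily₂ (W j - Winf) N εW (δ / 2))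
    (hδ : 0 < δ) (hN : 1 ≤ N) {γ₀ r : ℝ} (hrem : RemainderConst S γ₀ r) :
    BetaAvgAFH (min ((c.m₀ : ℚ) : ℝ) (binf - bandConst D (Fintype.card F) δ C Cv Cw (η k₀) εV εW) - r) 0 γ₀ β := by
  have hband := eventualBand_secondMoment_of_monotoneMajorant hA hAinf hC hdev hmono hη hV hVinf hW hWinf hVdev hWdev hδ hN μ ν
  have hband' : EventualBand S.β0 binf (bandConst D (Fintype.card F) δ C Cv Cw (η k₀) εV εW) k₀ := by
    intro k hk
    rw [hβ k, ← hlim]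
    exact hband k hk
  exact betaAvgAFH_of_rows_eventualBand S c hband' hk₀ hrem

end Assembly

/-! ## §6 Non-vacuity on the constant witness `β⁰ ≡ 1` (`CapRows.capRowsOne`) -/

open Beta.Assembly.Witness (splitOne)

/-- the constant sequence sits in the band of half-width `0` around `1` from `k₀ = 0`. [folklore] -/
theorem eventualBand_splitOne : EventualBand splitOne.β0 1 0 0 := fun k _ => by
  simp [Beta.Assembly.Witness.splitOne]

/-- the rows × band floor on the witness is `min 1 (1 − 0) = 1 ≤ β⁰ ≡ 1`. [folklore] -/
theorem floor_capRowsOne_band : ∀ k, min ((capRowsOne.m₀ : ℚ) : ℝ) (1 - 0) ≤ splitOne.β0 k :=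
  floor_of_rows_eventualBand capRowsOne eventualBand_splitOne (Nat.zero_le _)

end Summit.QuantumFields.BalabanUV.Beta.GAN24.Monotone
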